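import Summits.Ventures.HodgeRepro2.T5SU11KernelCompositionTwoSidedGlobalAll
import Summits.Ventures.HodgeRepro2.T5SU11KernelPowerSeries

/-!
# The difference of two kernels satisfies the two-sided `Ξ`-bound on the whole quadrant:
`|K_λ(t, s) − K_{λ₂}(t, s)| ≤ C |μ − μ₂| Ξ(t) Ξ(s)/(1 − |μ − μ₂|/(λ₂ − 1)²)`

Row 577's Neumann series `K_λ = Σ_k (μ − μ₂)^k K_{λ₂}^{∘(k+1)}` on the disc `|μ − μ₂| < (λ₂ − 1)²` has the singular kernel `K_{λ₂}`
as its `k = 0` term and, by row 649, every later term globally dominated by `C |μ − μ₂|^k Ξ(t) Ξ(s)/(λ₂ − 1)^{2(k−1)}`. Hence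

* `hasSum_kernel_sub_neumann` — `K_λ(t, s) − K_{λ₂}(t, s) = Σ_{n≥0} (μ − μ₂)^{n+1} K_{λ₂}^{∘(n+2)}(t, s)`;
* `exists_abs_kernel_sub_le_mul_sph_one` — **`∃ C > 0, ∀ t, s > 0, |K_λ(t, s) − K_{λ₂}(t, s)| ≤ C Ξ(t) Ξ(s)`** on the disc: the corner
  singularities of two kernels cancel (the kernel counterpart of row 644's cancellation for the decaying solutions), and the
  difference is globally dominated by `Ξ ⊗ Ξ`.

Nothing is claimed about (N).

Blind lane: Mathlib + the HodgeRepro2 prefix only; no sorry; axioms ⊆ {propext, Classical.choice,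
Quot.sound}.
-/

namespace Summit.Ventures.HodgeRepro2.T5SU11KernelDifferenceTwoSidedGlobal

open Filter Topology MeasureTheory
open Set (Ioi)
open T5SU11Cartan T5SU11SphericalFunction T5SU11SphericalBounds T5SU11SphericalDecay T5SU11RadialGreenKernel
  T5SU11RadialGreenImproper T5SU11KernelPowerSeries T5SU11KernelCompositionTwoSidedGlobalAll

section measure

variable [MeasurableSpace Circle] [BorelSpace Circle]

variable {lam lam₂ : ℝ} (hlam : 1 < lam) (hlam₂ : 1 < lam₂)

include hlam hlam₂ in
/-- **`K_λ(t, s) − K_{λ₂}(t, s) = Σ_{n≥0} (μ − μ₂)^{n+1} K_{λ₂}^{∘(n+2)}(t, s)`** on the disc `|μ − μ₂| < (λ₂ − 1)²`. -/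
theorem hasSum_kernel_sub_neumann (hq : |lam * (lam - 2) - lam₂ * (lam₂ - 2)| < (lam₂ - 1) ^ 2)
    {t s : ℝ} (ht : 0 < t) (hs : 0 < s) :
    HasSum (fun n : ℕ => (lam * (lam - 2) - lam₂ * (lam₂ - 2)) ^ (n + 1)
      * ((greenSolI (fun t => sph lam₂ (hyp t)) (sphDecay lam₂))^[n + 1] (fun r => sphGreenKernel lam₂ r s)) t)
      (sphGreenKernel lam t s - sphGreenKernel lam₂ t s) := by
  have h := hasSum_kernel_neumann hlam hlam₂ hs hq ht
  have h1 := (hasSum_nat_add_iff' 1).mpr h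
  simpa only [Finset.sum_range_one, pow_zero, Function.iterate_zero, id_eq, one_mul] using h1

include hlam hlam₂ in
/-- **THE DIFFERENCE OF TWO KERNELS SATISFIES THE TWO-SIDED `Ξ`-BOUND GLOBALLY**: on the disc `|μ − μ₂| < (λ₂ − 1)²`,
`∃ C > 0, ∀ t, s > 0, |K_λ(t, s) − K_{λ₂}(t, s)| ≤ C Ξ(t) Ξ(s)`. -/
theorem exists_abs_kernel_sub_le_mul_sph_one (hq : |lam * (lam - 2) - lam₂ * (lam₂ - 2)| < (lam₂ - 1) ^ 2) :
    ∃ C : ℝ, 0 < C ∧ ∀ t s, 0 < t → 0 < s →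
      |sphGreenKernel lam t s - sphGreenKernel lam₂ t s| ≤ C * sph 1 (hyp t) * sph 1 (hyp s) := by
  obtain ⟨C, hC, hC'⟩ := exists_abs_kernel_comp_le_mul_sph_one_all hlam₂
  set q := lam * (lam - 2) - lam₂ * (lam₂ - 2) with hqdef
  set ρ := |q| / (lam₂ - 1) ^ 2 with hρ
  have hμ : 0 < (lam₂ - 1) ^ 2 := by positivity
  have hρ0 : 0 ≤ ρ := div_nonneg (abs_nonneg _) hμ.le
  have hρ1 : ρ < 1 := (div_lt_one hμ).mpr hq
  refine ⟨C * |q| * (1 - ρ)⁻¹ + 1, by positivity, fun t s ht hs => ?_⟩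
  have hΞt : 0 < sph 1 (hyp t) := sph_hyp_pos 1 t
  have hΞs : 0 < sph 1 (hyp s) := sph_hyp_pos 1 s
  have hsum := hasSum_kernel_sub_neumann hlam hlam₂ hq ht hs
  -- termwise domination by the geometric series `C |q| Ξ(t) Ξ(s) ρⁿ`
  have hterm : ∀ n : ℕ, |q ^ (n + 1)
      * ((greenSolI (fun t => sph lam₂ (hyp t)) (sphDecay lam₂))^[n + 1] (fun r => sphGreenKernel lam₂ r s)) t|
      ≤ C * |q| * sph 1 (hyp t) * sph 1 (hyp s) * ρ ^ n := by
    intro n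
    rw [abs_mul, abs_pow, pow_succ]
    have h := hC' n t s ht hs
    have hqn : 0 ≤ |q| ^ n := pow_nonneg (abs_nonneg _) n
    calc |q| ^ n * |q| * |((greenSolI (fun t => sph lam₂ (hyp t)) (sphDecay lam₂))^[n + 1]
          (fun r => sphGreenKernel lam₂ r s)) t|
        ≤ |q| ^ n * |q| * (C / ((lam₂ - 1) ^ 2) ^ n * sph 1 (hyp t) * sph 1 (hyp s)) :=
          mul_le_mul_of_nonneg_left h (mul_nonneg hqn (abs_nonneg _))
      _ = C * |q| * sph 1 (hyp t) * sph 1 (hyp s) * ρ ^ n := by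
          rw [hρ, div_pow]
          field_simp
  have hgeom : Summable (fun n : ℕ => C * |q| * sph 1 (hyp t) * sph 1 (hyp s) * ρ ^ n) :=
    (summable_geometric_of_lt_one hρ0 hρ1).mul_left _
  have habs : Summable (fun n : ℕ => |q ^ (n + 1)
      * ((greenSolI (fun t => sph lam₂ (hyp t)) (sphDecay lam₂))^[n + 1] (fun r => sphGreenKernel lam₂ r s)) t|) :=
    Summable.of_nonneg_of_le (fun n => abs_nonneg _) hterm hgeom
  rw [← hsum.tsum_eq]
  calc |∑' n : ℕ, q ^ (n + 1)
        * ((greenSolI (fun t => sph lam₂ (hyp t)) (sphDecay lam₂))^[n + 1] (fun r => sphGreenKernel lam₂ r s)) t|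
      ≤ ∑' n : ℕ, |q ^ (n + 1)
        * ((greenSolI (fun t => sph lam₂ (hyp t)) (sphDecay lam₂))^[n + 1] (fun r => sphGreenKernel lam₂ r s)) t| := by
        have := norm_tsum_le_tsum_norm (f := fun n : ℕ => q ^ (n + 1)
          * ((greenSolI (fun t => sph lam₂ (hyp t)) (sphDecay lam₂))^[n + 1] (fun r => sphGreenKernel lam₂ r s)) t)
          (by simpa only [Real.norm_eq_abs] using habs)
        simpa only [Real.norm_eq_abs] using this
    _ ≤ ∑' n : ℕ, C * |q| * sph 1 (hyp t) * sph 1 (hyp s) * ρ ^ n := Summable.tsum_le_tsum hterm habs hgeom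
    _ = C * |q| * sph 1 (hyp t) * sph 1 (hyp s) * (1 - ρ)⁻¹ := by
        rw [tsum_mul_left, tsum_geometric_of_lt_one hρ0 hρ1]
    _ ≤ (C * |q| * (1 - ρ)⁻¹ + 1) * sph 1 (hyp t) * sph 1 (hyp s) := by
        have h1 : 0 < (1 - ρ)⁻¹ := inv_pos.mpr (by linarith)
        nlinarith [mul_pos hΞt hΞs]

end measure

end Summit.Ventures.HodgeRepro2.T5SU11KernelDifferenceTwoSidedGlobal
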